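import Summits.Parity.GeneralizedHardyLittlewood.Theorems.PrimeLevelFamEdgeMomentsBeyondDiagonalDiagDecorMasterInputs
import HarnessLib

/-!
# Route `PrimeLevelFamEdge`, crux K_A `MomentsBeyondDiagonal` (stmt-Parity-20007), line «petersson_layers» v4, stub `stub_diag`:
# **the `(log k)^σ` shift of a decorated profile coordinate (exact expansion) and two more evaluated monomials of the
# order-`(1,1)` weight: `τ_{1,0}·τ_{1,0} ↦ ζ(2)²∫₀¹P′²/log M`, `τ·τ_{1,1} ↦ ζ(2)²∫₀¹P″P/log M`**

Census R3(ii), ANALYTIC HALF. (1) The monomials of the order-`(i,j)` weight carry, besides the divisor decorations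
`τ_{α,β}(k)`, plain powers `(log k)^σ` (from `L = 2(ℓ − log g) − log k₁ − log k₂`). At the PROFILE level these are removed
exactly: with `Y = log(M/n)`, `L_k = log((M/n)/k)`, `log k = Y − L_k`,
`Σ_c P_c(Σ_k w(k)(log k)^σ L_kᶜ)/logᶜM = Σ_{j≤σ} C(σ,j)(−1)^j Y^{σ−j} log^jM · Σ_c P_c(Σ_k w(k)L_k^{c+j})/log^{c+j}M`
(`profile_logPow_expand`) — the inner brackets are the profile coordinates of `w` at the shifted orders `c+j` (equivalently
with the profile `X^j·P`), to which `…DiagDecorProfileCoord.abs_profileLayer_sub_le` and the `k`-engines apply.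
(2) Two further turnkey instances of the master step (`…DiagDecorMasterInputs`, `…DiagDecorBilinearTwoScale`):

* `abs_selbergMonomial_tau10_tau10_sub_le` — `τ_{1,0}(k₁)τ_{1,0}(k₂) ↦ (π²/6)²(∫₀¹P′²)·log M/log²M + O(1/log²M)`;
* `abs_selbergMonomial_tau_tau11_sub_le` — `τ(k₁)τ_{1,1}(k₂) ↦ (π²/6)²(∫₀¹P″P)·log M/log²M + O(1/log²M)` (mixed two-scale case).

Def-free; theorems only. Helper `--supports stmt-Parity-20007`; closes nothing; K_A, K_B and the Parity summit are NOT proved;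
nothing about Landau–Siegel zeros.

## References
* E. Kowalski, P. Michel, J. VanderKam, J. reine angew. Math. 526 (2000), (23)–(28) pp. 13–15 and Prop. 5.1 p. 18.
  [cite: KowalskiMichelVanderKam2000, (23)–(28) — derivation (monomials of the diagonal main term in real variables)]
-/

noncomputable section

open scoped Real ArithmeticFunction.Moebius
open Finset ArithmeticFunction Polynomial MeasureTheory intervalIntegral

namespace Summit.Parity.GeneralizedHardyLittlewood.Theorems.MomentsBeyondDiagonal.DiagKernel

open Literature.NumberTheory.LFunctions Literature.NumberTheory.LFunctions.KMV2000
open MollifierMainTerm (W)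
open SelbergCoord (kappa)
open Literature.NumberTheory.Sieve (one_le_log_of_three_le)
open Summit.Parity.GeneralizedHardyLittlewood.Theorems.BeyondDiagonalBeatsQuarter.KernelFormXSq (mainConst divWeight)
open Summit.Parity.GeneralizedHardyLittlewood.Theorems.MomentsBeyondDiagonal.DiagLines (sum_mul_log_pow_mul_log_div_pow_eq)

/-! ### The `(log k)^σ` shift at the profile level -/

/-- **The `(log k)^σ` shift of a profile coordinate** (exact): for `M > 0` with `log M ≠ 0`, `n ≥ 1`, any weight `w`,
`Σ_c P_c(Σ_{k≤M/n} w(k)(log k)^σ logᶜ((M/n)/k))/logᶜM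
 = Σ_{j≤σ} C(σ,j)(−1)^j log^{σ−j}(M/n)·log^jM·Σ_c P_c(Σ_{k≤M/n} w(k)log^{c+j}((M/n)/k))/log^{c+j}M`.
[cite: KowalskiMichelVanderKam2000, (23)–(28) — derivation (bookkeeping of the log k powers)] -/
theorem profile_logPow_expand (P : ℝ[X]) {M : ℝ} (hM : 0 < M) (hℓ : Real.log M ≠ 0) {n : ℕ} (hn : n ≠ 0)
    (w : ℕ → ℝ) (σ : ℕ) :
    ∑ c ∈ Finset.range (P.natDegree + 1), P.coeff c *
        ((∑ k ∈ Icc 1 ⌊M / n⌋₊, w k * Real.log k ^ σ * Real.log (M / n / k) ^ c) / Real.log M ^ c) =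
      ∑ j ∈ Finset.range (σ + 1), (σ.choose j : ℝ) * (-1) ^ j * Real.log (M / n) ^ (σ - j) * Real.log M ^ j *
        ∑ c ∈ Finset.range (P.natDegree + 1), P.coeff c *
          ((∑ k ∈ Icc 1 ⌊M / n⌋₊, w k * Real.log (M / n / k) ^ (c + j)) / Real.log M ^ (c + j)) := by
  have hn0 : (0 : ℝ) < n := by exact_mod_cast Nat.pos_of_ne_zero hn
  have hy : 0 < M / n := div_pos hM hn0
  -- expand every inner sum
  have hinner : ∀ c : ℕ, ∑ k ∈ Icc 1 ⌊M / n⌋₊, w k * Real.log k ^ σ * Real.log (M / n / k) ^ c =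
      ∑ j ∈ Finset.range (σ + 1), (σ.choose j : ℝ) * Real.log (M / n) ^ (σ - j) * (-1) ^ j *
        ∑ k ∈ Icc 1 ⌊M / n⌋₊, w k * Real.log (M / n / k) ^ (c + j) :=
    fun c ↦ sum_mul_log_pow_mul_log_div_pow_eq hy w σ c
  simp_rw [hinner]
  -- expand to triple sums, swap `c ↔ j`, and insert `log^jM / log^{c+j}M = 1/logᶜM` termwise
  simp only [Finset.sum_div, Finset.mul_sum]
  rw [Finset.sum_comm]
  refine Finset.sum_congr rfl fun j _ ↦ Finset.sum_congr rfl fun c _ ↦ Finset.sum_congr rfl fun k _ ↦ ?_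
  rw [pow_add]
  field_simp
  ring

/-! ### Two more evaluated monomials of the order-(1,1) weight -/

/-- **The `τ_{1,0}(k₁)τ_{1,0}(k₂)` monomial**: `(π²/6)²(∫₀¹P′²)·log M/log²M + O(1/log²M)` (`P₀ = P₁ = 0`).
[cite: KowalskiMichelVanderKam2000, (23)–(28) and Prop. 5.1 — derivation] -/
theorem abs_selbergMonomial_tau10_tau10_sub_le (P : ℝ[X]) (hP0 : P.coeff 0 = 0) (hP1 : P.coeff 1 = 0) :
    ∃ C : ℝ, 0 < C ∧ ∀ M : ℝ, 3 ≤ M →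
      |∑ c ∈ Icc 1 ⌊M⌋₊, ∑ g ∈ Icc 1 (⌊M⌋₊ / c), (μ g : ℝ) * c *
          ∑ k₁ ∈ Icc 1 (⌊M⌋₊ / (c * g)), ∑ k₂ ∈ Icc 1 (⌊M⌋₊ / (c * g)),
            ((μ (c * g * k₁) : ℝ) * ((psi (c * g * k₁))⁻¹ *
                P.eval (Real.log (M / ((c * g * k₁ : ℕ) : ℝ)) / Real.log M))) / ((c * g * k₁ : ℕ) : ℝ) *
              (((μ (c * g * k₂) : ℝ) * ((psi (c * g * k₂))⁻¹ *
                P.eval (Real.log (M / ((c * g * k₂ : ℕ) : ℝ)) / Real.log M))) / ((c * g * k₂ : ℕ) : ℝ)) *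
              ((∑ d ∈ k₁.divisors, Real.log d) * (∑ d ∈ k₂.divisors, Real.log d)) -
        (π ^ 2 / 6) ^ 2 * (∫ u in (0 : ℝ)..1, ((-derivative P) * (-derivative P)).eval u) * Real.log M /
          Real.log M ^ (1 + 1)| ≤ C / Real.log M ^ (1 + 1) := by
  obtain ⟨C₁, hC₁, h₁⟩ := masterInput_tau10 P hP0 hP1
  exact abs_selbergMonomial_two_scale_sub_le P (fun k ↦ ∑ d ∈ k.divisors, Real.log d)
    (fun k ↦ ∑ d ∈ k.divisors, Real.log d) (-derivative P) (-derivative P) 1 1 hC₁ hC₁ h₁ h₁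

/-- **The mixed `τ(k₁)τ_{1,1}(k₂)` monomial** (two-scale input for `τ`): `(π²/6)²(∫₀¹P″P)·log M/log²M + O(1/log²M)`
(`P₀ = P₁ = 0`). [cite: KowalskiMichelVanderKam2000, (23)–(28) and Prop. 5.1 — derivation] -/
theorem abs_selbergMonomial_tau_tau11_sub_le (P : ℝ[X]) (hP0 : P.coeff 0 = 0) (hP1 : P.coeff 1 = 0) :
    ∃ C : ℝ, 0 < C ∧ ∀ M : ℝ, 3 ≤ M →
      |∑ c ∈ Icc 1 ⌊M⌋₊, ∑ g ∈ Icc 1 (⌊M⌋₊ / c), (μ g : ℝ) * c *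
          ∑ k₁ ∈ Icc 1 (⌊M⌋₊ / (c * g)), ∑ k₂ ∈ Icc 1 (⌊M⌋₊ / (c * g)),
            ((μ (c * g * k₁) : ℝ) * ((psi (c * g * k₁))⁻¹ *
                P.eval (Real.log (M / ((c * g * k₁ : ℕ) : ℝ)) / Real.log M))) / ((c * g * k₁ : ℕ) : ℝ) *
              (((μ (c * g * k₂) : ℝ) * ((psi (c * g * k₂))⁻¹ *
                P.eval (Real.log (M / ((c * g * k₂ : ℕ) : ℝ)) / Real.log M))) / ((c * g * k₂ : ℕ) : ℝ)) *
              ((k₁.divisors.card : ℝ) * (∑ d ∈ k₂.divisors, Real.log d * Real.log ((k₂ / d : ℕ) : ℝ))) -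
        (π ^ 2 / 6) ^ 2 * (∫ u in (0 : ℝ)..1, (derivative (derivative P) * P).eval u) * Real.log M /
          Real.log M ^ (2 + 0)| ≤ C / Real.log M ^ (2 + 0) := by
  obtain ⟨C₁, hC₁, h₁⟩ := masterInput_tau P hP0 hP1
  obtain ⟨C₂, hC₂, h₂⟩ := masterInput_tau11 P hP0 hP1
  exact abs_selbergMonomial_two_scale_sub_le P (fun k ↦ (k.divisors.card : ℝ))
    (fun k ↦ ∑ d ∈ k.divisors, Real.log d * Real.log ((k / d : ℕ) : ℝ)) (derivative (derivative P)) P 2 0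
    hC₁ hC₂ h₁ h₂

end Summit.Parity.GeneralizedHardyLittlewood.Theorems.MomentsBeyondDiagonal.DiagKernel

end
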